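import Summits.CriticalPhenomena.Ising3D.TaylorGerm
import Mathlib.Tactic.Linarith
import HarnessLib

/-!
# The `(0,0)` Taylor coefficient is evaluation (bridge between the point and derivative classes)
(cell `pub-ising3x`, seat boot-1; sanity lemma for gate (g0))

HONEST FRAMING: lottery ticket; floor = tightest certified 3D Ising CFT bounds; no exact-solution
claim without a proof.

On a function with a Taylor germ at `(x₀,y₀)` the coefficient functional `taylorCoeffAt x₀ y₀ (0,0)` is
point evaluation at `(x₀,y₀)` (`taylorCoeffAt_zero_eq_eval`): the Λ = 0 derivative functional at a diagonal
node is the one-node point functional there, on every block term (both have germs), so the γ class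
contains the diagonal part of the β class. Elementary (`h = k = 0` in the expansion).
-/

namespace Summit.CriticalPhenomena.Ising3D

open Set

/-- The expansion at `h = k = 0` reads `F(x₀,y₀) = T(0,0)`. [folklore] -/
theorem HasTaylorGerm.coeff_zero_eq {F : ℝ → ℝ → ℝ} {x₀ y₀ r : ℝ} {T : ℕ × ℕ → ℝ}
    (hF : HasTaylorGerm F x₀ y₀ r T) : T (0, 0) = F x₀ y₀ := by
  have h0 : |(0 : ℝ)| < r := by rw [abs_zero]; exact hF.pos
  have hs := hF.hasSum h0 h0
  rw [add_zero, add_zero] at hs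
  have h1 : HasSum (fun p : ℕ × ℕ => T p * (0 : ℝ) ^ p.1 * (0 : ℝ) ^ p.2) (T (0, 0)) := by
    have := hasSum_single (f := fun p : ℕ × ℕ => T p * (0 : ℝ) ^ p.1 * (0 : ℝ) ^ p.2) (0, 0)
      (fun p hp => by
        obtain ⟨a, b⟩ := p
        rcases Nat.eq_zero_or_pos a with ha | ha
        · subst ha
          have hb : b ≠ 0 := fun hb => hp (by rw [hb])
          simp [zero_pow hb]
        · simp [zero_pow (Nat.pos_iff_ne_zero.mp ha)])
    simpa using this
  exact h1.unique hs

/-- **`taylorCoeffAt x₀ y₀ (0,0) F = F(x₀,y₀)`** on functions with a germ. [folklore] -/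
theorem taylorCoeffAt_zero_eq_eval {F : ℝ → ℝ → ℝ} {x₀ y₀ r : ℝ} {T : ℕ × ℕ → ℝ}
    (hF : HasTaylorGerm F x₀ y₀ r T) : taylorCoeffAt x₀ y₀ (0, 0) F = F x₀ y₀ := by
  rw [taylorCoeffAt_eq hF, hF.coeff_zero_eq]

end Summit.CriticalPhenomena.Ising3D
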